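import Summits.HodgeConjecture.CorCM.HypLiu418.A3Liu418GSOmegaStarIrreducibleOrZero
import Summits.HodgeConjecture.CorCM.HypLiu418.A3Liu418GSOmegaStarSmooth
import Summits.HodgeConjecture.CorCM.HypLiu418.A3Liu418GSThmD6OneCurve
import Summits.HodgeConjecture.HodgeConjecture.Theorems.HLiu418ScalarSpectralJunction
import Summits.HodgeConjecture.HodgeConjecture.Theorems.H413SpectrumJunction
import Summits.HodgeConjecture.CorCM.HypLiu418.A3Liu418GSInstance
import Literature.NumberTheory.Automorphic.UnitaryGroupFormTransport
import Literature.NumberTheory.Automorphic.UnitaryCurveCohCotangentFormsContinuous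
import Literature.NumberTheory.Automorphic.UnitaryCurveCotangentSpectralProjection
import Literature.NumberTheory.Automorphic.UnitaryCurveCotangentSpectralProjectionHerm   -- ed. 2: the (D₂) letters APPLIED at hermitian `σ_{w(ι₁)}J⋆` (R1 (α-lite), road (i′))
import Summits.HodgeConjecture.HodgeConjecture.Theorems.HLiu418CurveHodgeTypesDisjoint   -- ed. 2: `isHermitian_map_of_formCongr`
import Literature.NumberTheory.Rogawski1990.CurveThetaHodgeTypeSigned
import Literature.NumberTheory.Automorphic.Liu2021.RemD5CompanionAdmissibility
import Literature.NumberTheory.Automorphic.IdeleClassCharacterConjugate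
import Literature.NumberTheory.Automorphic.AdelicUnitaryGroupSpectrum
import Literature.NumberTheory.Automorphic.AdelicUnitaryGroupDatum
import Literature.NumberTheory.ComplexMultiplication.CMTypeBasic
import Literature.AlgebraicGeometry.Liu2021.AdmissibleElement
import Literature.NumberTheory.Rogawski1990.CurveThetaHodgeTypeNecessity   -- T0′: the NECESSITY letters E3nec₂
import Summits.HodgeConjecture.HodgeConjecture.Theorems.F0AlbCmS1bSignedExclusion   -- the E3₂ twin (for `exists_locF_eq_epsOf`)
import HarnessLib

/-!
# Crux `HLiu418`, line `F0_AlbCm`, sub-sub-line `F0_AlbCmS1bHodge` — the stub `stub_S1b_signedExclusion : S1bSignedExclusionShape` CLOSED ON THE NECESSITY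
# LETTERS E3nec₂ (★ `Rogawski1990/CurveThetaHodgeTypeNecessity`) instead of the signed biconditionals E3₂ — twin of ★ `Theorems/F0AlbCmS1bSignedExclusion.lean`

Floor-0 programme P5 (Alb-CM), seat F0P5-p02 (g4) («T2′» of the P5 desk's word #11, 2026-08-31); crux item stmt-HodgeConjecture-24832 (`HCCMUnconditional.HLiu418`).
THEOREMS ONLY, def-free, `sorry`-free.  HC_CM is proved only modulo the 7 printed citations until rung 0 closes.  = ★ `F0AlbCmS1bSignedExclusion.lean` (F0P5-p02 (g0),
p796247; its §0 helpers and §1 anisotropy lemma re-pasted as private copies, its `exists_locF_eq_epsOf` IMPORTED) VERBATIM except for exactly TWO proof tokens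
and the two hypothesis types: the census (F0P5-p02 (g4) `F0/P5/p02/CENSUS-E3-direction.v1`, desk word #11) found that the ★ twin consumes the signed letters
`curveThetaHodgeTypeSigned_hol ∕ _antihol` (biconditionals `e♮ ∈ Φ_λ ↔ adm` ∕ `↔ ¬adm`) ONLY through `key.2 hadm'` (hol branch: adm → `e♮ ∈ Φ_λ`) and `key.1 hh hadm'`
(antihol branch: `e♮ ∈ Φ_λ` → ¬adm), both under `hadm'` (λ-admissibility of `ε_a`, supplied by the crux binder `_hadm`); so the NECESSITY letters
`curveThetaHodgeTypeNecessity_hol ∕ _antihol` («occurrence ∧ admissible ⇒ sign of `e♮`», [Liu2021, Rem. D.5] «only if» half) suffice: here `key hadm'` resp.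
`key hadm' hh`.  Conclusion = the TYPE of `stub_S1b_signedExclusion : S1bSignedExclusionShape` of `Cruxes/HLiu418/Lines/F0_AlbCmS1bHodge.lean` TOKEN FOR TOKEN
(unchanged), so ★ `F0AlbCmS1bHodgeHolds` re-feeds by name (`Theorems/F0AlbCmS1bHodgeHoldsNec.lean`, T4′a).

MATHEMATICS (as in the ★ twin; [Liu2021, Rem. D.5; Lem. D.2 (3); proof of Thm. D.6 (1), p. 140]).  Fix the crux data and a cone frame `𝔣` at `w(ι₁)`; put
`λ := μ ∘ c` (conjugate symplectic of weight one, `Φ_λ = Φ̄_μ`, ★ `IsConjugateSymplectic.cmType_galConj`, ★ `HasWeight.galConj_complexConj`), `a := r ε`, so the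
registered carrier `ω⋆_lab` IS `ω(λ, ε_a, χ)_f ∘ (finAdelicCongr g⋆)⁻¹` and `ε_a = ε` is λ-ADMISSIBLE by `_hadm` and [Liu2021, Def. 4.12, last sentence] (★
`RemD5.exists_isAdmissibleElement_neg_iff_bar`).  BRANCH `e♮ ∈ Φ_μ`: a non-zero `ω⋆_lab → holCotForms₂ 𝔣` intertwiner `ψ` yields (★ `exists_isAutomorphicMeasure_isDiscretelyDecomposable`,
★ `exists_discreteAutomorphicRep_not_orthogonal_hasFinComponent`, (D₂) at hermitian `σ_{w(ι₁)}J⋆`) a discrete `P` of type `(1,0)` with finite component `ω⋆_lab`;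
E3nec-hol gives `e♮ ∈ Φ_λ = Φ̄_μ`, contradicting `e♮ ∈ Φ_μ`.  BRANCH `e♮ ∉ Φ_μ`: symmetrically with the conjugate carriers and E3nec-antihol (`e♮ ∉ Φ_λ = Φ̄_μ`, i.e.
`e♮ ∈ Φ_μ`, contradiction).

References: [Liu2021] Camb. J. Math. 9 (2021): Def. 4.12, Rem. 4.4, App. D Lem. D.1 (4), Lem. D.2 (3), Prop. D.4 (1), Rem. D.5 (p. 131), proof of Thm. D.6 (1);
[Rogawski1990] Ann. of Math. Stud. 123, §11 (Prop. 11.1.1, 11.2.1, Thm. 11.5.1); [HarrisKudlaSweet1996] Thm. 6.1; [BorelWallach2000] VII 2.10, 3.2; [BorelJacquet1979] §4.6;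
[Dixmier1977] §5.4; [GelfandGraevPiatetskiShapiro1969] Ch. 1 §2.3.
-/

set_option linter.dupNamespace false

noncomputable section

namespace Summit.HodgeConjecture.HodgeConjecture.Cruxes.HLiu418.F0AlbCmS1bSignedExclusionNec

open scoped TensorProduct Matrix NumberField Kronecker ComplexOrder InnerProductSpace ENNReal
open MeasureTheory
open NumberField NumberField.InfinitePlace IsDedekindDomain
open Summit.HodgeConjecture.CorCM.Model Summit.HodgeConjecture.CorCM.Model.HComp Summit.HodgeConjecture.CorCM.HComp
open Literature.AlgebraicGeometry.Motives (CMType AbelianVariety)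
open Literature.AlgebraicGeometry.ShimuraVarieties Literature.AlgebraicGeometry.ShimuraVarieties.UnitaryCanonicalModel
open Literature.NumberTheory.Automorphic Literature.NumberTheory.Automorphic.UnitaryGroup Literature.NumberTheory.Automorphic.UnitaryCurveForms
open Literature.NumberTheory.Automorphic.UnitaryGroup.CotangentForms (toQuotFun toQuotFun_mk)
open Literature.NumberTheory.Automorphic.IdeleClassGroup Literature.NumberTheory.Automorphic.Liu2021 Literature.NumberTheory.Automorphic.Liu2021.AppendixC
open Literature.NumberTheory.GaloisRepresentations Literature.RepresentationTheory.Liu2021 Literature.RepresentationTheory.HarrisKudlaSweet1996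
open Literature.AlgebraicGeometry.Liu2021 (IsAdmissibleElement)
open Literature.NumberTheory.Weil1964 Literature.NumberTheory.GelbartRogawski1991 Literature.NumberTheory.GelbartRogawski1991.UnitaryDualPair Literature.NumberTheory.GelbartRogawski1991.UnitaryDualPair.WeilCoinv
open Literature.NumberTheory.GelbartRogawski1991.UnitaryDualPair.LocalSplitting
open Literature.NumberTheory.Automorphic.Liu2021.Def411WeilCarriersDoubling
open Literature.NumberTheory.Automorphic.Liu2021.Def411WeilCarriers (TW JW JW_eq isSymm_TW isUnit_det_TW Rep Eps epsOf locF Chi rhoVAtLine rhoAtLine omegaAtLine)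
open Literature.NumberTheory.Automorphic.Liu2021.RemD5 (exists_isAdmissibleElement_neg_iff_bar)
open Literature.NumberTheory.ComplexMultiplication.CMTypeOps (bar mem_bar_iff)
open Summit.HodgeConjecture.CorCM (CMField)
open Summit.HodgeConjecture.CorCM.Lines.A3Liu418
open Summit.HodgeConjecture.HodgeConjecture.Cruxes.H413.F0P3HilbertProjection
open Summit.HodgeConjecture.HodgeConjecture.Cruxes.H413.SpectrumJunction
open Summit.HodgeConjecture.HodgeConjecture.Cruxes.HLiu418.ScalarSpectralJunction
open Summit.HodgeConjecture.HodgeConjecture.Cruxes.HLiu418.F0AlbCmS1bSignedExclusion (exists_locF_eq_epsOf)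

/-! ## §0 Helpers PASTED from F0P5-p03 (g0) `HLiu418S1BettiSliceExclusion` §1–§2 (private copies with attribution, so that this file waits only
for the junction module T1; to be replaced by `import` once that file is ★) -/

section Helpers

variable {F₀ E : Type} [Field F₀] [NumberField F₀] [Field E] [NumberField E] [Algebra F₀ E]
  {c : E ≃ₐ[F₀] E} {J : Matrix (Fin 2) (Fin 2) E}
  {hc : c ≠ 1} {hfix : ∀ w : InfinitePlace E, c • w = w} {w₁ : {w : InfinitePlace E // IsComplex w}} {𝔣 : ConeFrame E J w₁}

/-- Holomorphic curve cotangent forms are left-`U(J)(F)`-invariant under the quotient subgroup of the unitary datum (clause (L) of `holCotForms₂`;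
`U(J)` has trivial split component, ★ `quotientSubgroup_adelicGroupData`). [cite: BorelJacquet1979, §4.2] -/
private theorem leftInvariant_of_mem_holCotForms₂ {f : (adelicGroupData F₀ E c 2 J).Adelic → ℂ} (hf : f ∈ holCotForms₂ F₀ E c J hc hfix w₁ 𝔣) :
    ∀ γ ∈ (adelicGroupData F₀ E c 2 J).quotientSubgroup, ∀ x, f (γ * x) = f x := by
  intro γ hγ x
  rw [quotientSubgroup_adelicGroupData] at hγ
  obtain ⟨γ₀, rfl⟩ := hγ
  exact ((mem_holCotForms₂_iff F₀ E c J hc hfix w₁ 𝔣 f).1 hf).1 γ₀ x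

/-- Antiholomorphic curve cotangent forms are left-`U(J)(F)`-invariant. [cite: BorelJacquet1979, §4.2] -/
private theorem leftInvariant_of_mem_map_conjFun₂ {f : (adelicGroupData F₀ E c 2 J).Adelic → ℂ}
    (hf : f ∈ (holCotForms₂ F₀ E c J hc hfix w₁ 𝔣).map (conjFun₂ F₀ E c J)) :
    ∀ γ ∈ (adelicGroupData F₀ E c 2 J).quotientSubgroup, ∀ x, f (γ * x) = f x := by
  intro γ hγ x
  obtain ⟨f₀, hf₀, rfl⟩ := Submodule.mem_map.1 hf
  show star (f₀ (γ * x)) = star (f₀ x)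
  rw [leftInvariant_of_mem_holCotForms₂ hf₀ γ hγ x]

/-- If every holomorphic curve cotangent form is continuous, so is every antiholomorphic one (`conjFun₂ f = star ∘ f`). [folklore] -/
private theorem continuous_of_mem_map_conjFun₂
    (hcont : ∀ f ∈ holCotForms₂ F₀ E c J hc hfix w₁ 𝔣, Continuous f) {f : (adelicGroupData F₀ E c 2 J).Adelic → ℂ}
    (hf : f ∈ (holCotForms₂ F₀ E c J hc hfix w₁ 𝔣).map (conjFun₂ F₀ E c J)) : Continuous f := by
  obtain ⟨f₀, hf₀, rfl⟩ := Submodule.mem_map.1 hf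
  show Continuous fun x => star (f₀ x)
  exact continuous_star.comp (hcont f₀ hf₀)

end Helpers

/-! ## §2 `J⋆` is anisotropic: a rational frame `ᵗ(c g⋆) (t • J⋆) g⋆ = diag dJ` with `diag dJ` positive definite at ONE complex place -/

section Anisotropy

variable (L : Type) [Field L] [NumberField L] [IsCMField L]

omit [NumberField L] [IsCMField L] in
/-- `⟪v, w⟫_{σ(T)ᵀ H T} = ⟪T v, T w⟫_H`: the form of a congruent Gram matrix. [folklore] -/
private theorem hermForm_formCongr (σ : L →+* L) (T : GL (Fin 2) L) (H : Matrix (Fin 2) (Fin 2) L) (v w : Fin 2 → L) :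
    Literature.AlgebraicGeometry.ShimuraVarieties.hermForm σ (formCongr σ T H) v w = Literature.AlgebraicGeometry.ShimuraVarieties.hermForm σ H ((T : Matrix (Fin 2) (Fin 2) L) *ᵥ v) ((T : Matrix (Fin 2) (Fin 2) L) *ᵥ w) := by
  have h1 : (⇑σ ∘ ((T : Matrix (Fin 2) (Fin 2) L) *ᵥ v)) = ((T : Matrix (Fin 2) (Fin 2) L).map σ) *ᵥ (⇑σ ∘ v) :=
    funext fun i => RingHom.map_mulVec σ _ v i
  show (⇑σ ∘ v) ⬝ᵥ ((((T : Matrix (Fin 2) (Fin 2) L).map σ)ᵀ * H * (T : Matrix (Fin 2) (Fin 2) L)) *ᵥ w) =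
    (⇑σ ∘ ((T : Matrix (Fin 2) (Fin 2) L) *ᵥ v)) ⬝ᵥ (H *ᵥ ((T : Matrix (Fin 2) (Fin 2) L) *ᵥ w))
  rw [h1, ← Matrix.mulVec_mulVec, ← Matrix.mulVec_mulVec, Matrix.dotProduct_mulVec (⇑σ ∘ v), Matrix.vecMul_transpose]

/-- The coercion of `IsCMField.complexConj` to a ring homomorphism IS `cmConjRingHom` (pointwise `rfl`). [folklore] -/
private theorem coe_complexConj_eq_cmConjRingHom :
    ((IsCMField.complexConj L : L ≃ₐ[↥(maximalRealSubfield L)] L) : L →+* L) = cmConjRingHom L :=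
  RingHom.ext fun _ => rfl

/-- **`J⋆` IS ANISOTROPIC.**  If `ᵗ(c g⋆) (t • J⋆) g⋆ = diag dJ` (`g⋆ ∈ GL₂(L)`) and `diag dJ` is positive definite at some complex
embedding `τ`, then `⟪x, x⟫_{J⋆} = 0 ⇒ x = 0` on `L²` (no hypothesis on `t` is needed): `t ⟪x, x⟫_{J⋆} = ⟪g⋆⁻¹x, g⋆⁻¹x⟫_{diag dJ}` and `diag dJ` is anisotropic (★
`anisotropic_of_posDef_map`).  This is the hypothesis of ★ `exists_isAutomorphicMeasure_isDiscretelyDecomposable_adelicGroupData` and of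
★ `compactSpace_cmDatum_automorphicQuotient`. [folklore] -/
private theorem anisotropic_of_formCongr_posDef (Jstar : Matrix (Fin 2) (Fin 2) L) (t : L) (gstar : GL (Fin 2) L)
    (dJ : Fin 2 → L)
    (hg : formCongr ((IsCMField.complexConj L : L ≃ₐ[↥(maximalRealSubfield L)] L) : L →+* L) gstar (t • Jstar) = Matrix.diagonal dJ)
    (τ : L →+* ℂ) (hτ : ((Matrix.diagonal dJ).map τ).PosDef) :
    ∀ x : Fin 2 → L, Literature.AlgebraicGeometry.ShimuraVarieties.hermForm (cmConjRingHom L) Jstar x x = 0 → x = 0 := by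
  intro x hx
  have hD := UnitaryGroup.anisotropic_of_posDef_map L (Matrix.diagonal dJ) τ hτ
  rw [coe_complexConj_eq_cmConjRingHom] at hg
  have hM : t • Jstar = formCongr (cmConjRingHom L) gstar⁻¹ (Matrix.diagonal dJ) := by
    rw [← hg, formCongr_inv_formCongr]
  have h1 : Literature.AlgebraicGeometry.ShimuraVarieties.hermForm (cmConjRingHom L) (t • Jstar) x x = t * Literature.AlgebraicGeometry.ShimuraVarieties.hermForm (cmConjRingHom L) Jstar x x := by
    show (⇑(cmConjRingHom L) ∘ x) ⬝ᵥ ((t • Jstar) *ᵥ x) = t * ((⇑(cmConjRingHom L) ∘ x) ⬝ᵥ (Jstar *ᵥ x))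
    rw [Matrix.smul_mulVec, dotProduct_smul, smul_eq_mul]
  have h2 : Literature.AlgebraicGeometry.ShimuraVarieties.hermForm (cmConjRingHom L) (Matrix.diagonal dJ) (((gstar⁻¹ : GL (Fin 2) L) : Matrix (Fin 2) (Fin 2) L) *ᵥ x)
      (((gstar⁻¹ : GL (Fin 2) L) : Matrix (Fin 2) (Fin 2) L) *ᵥ x) = 0 := by
    rw [← hermForm_formCongr, ← hM, h1, hx, mul_zero]
  have h3 := hD _ h2
  have hx' : x = ((gstar : GL (Fin 2) L) : Matrix (Fin 2) (Fin 2) L) *ᵥ ((((gstar⁻¹ : GL (Fin 2) L) : Matrix (Fin 2) (Fin 2) L)) *ᵥ x) := by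
    rw [Matrix.mulVec_mulVec, ← Units.val_mul, mul_inv_cancel, Units.val_one, Matrix.one_mulVec]
  rw [hx', h3, Matrix.mulVec_zero]

end Anisotropy


set_option synthInstance.maxHeartbeats 400000 in
set_option maxHeartbeats 4000000 in
/-- **THE `S1bSignedExclusion` FOLD ON THE NECESSITY LETTERS — [Liu2021, Rem. D.5] «only if» half at the registered label `ω⋆_lab`, in forms currency, from E3nec₂
(`hE3hol` ∕ `hE3antihol` : ★ `Rogawski1990.curveThetaHodgeTypeNecessity_hol ∕ _antihol`, BY NAME; consumed as `key hadm'` ∕ `key hadm' hh`) and the representable analytic letters (D₂)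
(`hTPhol` ∕ `hTPantihol` : ★ `UnitaryCurveForms.holCotFormSpectralProjection₂ ∕ antiholCotFormSpectralProjection₂`, BY NAME).**  Conclusion = the TYPE of
`stub_S1b_signedExclusion : S1bSignedExclusionShape` of `Cruxes/HLiu418/Lines/F0_AlbCmS1bHodge.lean` (F0P5-p04 rf v2 0bdf0d82, with `h4`) TOKEN FOR TOKEN.
Proof in the module docstring.  HC_CM is proved only modulo the 7 printed citations until rung 0 closes.
[cite: Liu2021, App. D Rem. D.5 (p. 131); Prop. D.4 (1) and its proof (p. 130–131); Lem. D.1 (4); Lem. D.2 (3); Def. 4.12; Rem. 4.4]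
[cite: Rogawski1990, §11.1 Prop. 11.1.1; Prop. 11.2.1 (b); Thm. 11.5.1 (b)] [cite: BorelJacquet1979, §4.6] -/
theorem stub_S1b_signedExclusion_of_nec_letters
    (hE3hol : Literature.NumberTheory.Rogawski1990.curveThetaHodgeTypeNecessity_hol)
    (hE3antihol : Literature.NumberTheory.Rogawski1990.curveThetaHodgeTypeNecessity_antihol)
    (hTPhol : Literature.NumberTheory.Automorphic.UnitaryCurveForms.holCotFormSpectralProjection₂)
    (hTPantihol : Literature.NumberTheory.Automorphic.UnitaryCurveForms.antiholCotFormSpectralProjection₂) :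
    ∀ (F : CMField) [IsGalois ℚ F] (ι₁ : F →+* ℂ)
      (μ : Literature.NumberTheory.Automorphic.IdeleClassGroup (F : Type) →ₜ* Circle)
      (hμ : IdeleClassGroup.IsConjugateSymplectic (F : Type) μ)
      (_hw : IdeleClassGroup.HasWeight (F : Type) μ 1)
      (Jstar : Matrix (Fin 2) (Fin 2) (F : Type)) (t : (F : Type)) (ht : t ≠ 0) (_hτt : 0 < (ι₁ t).re) (_hτt' : (ι₁ t).im = 0)
      (gstar : GL (Fin 2) (F : Type))
      (dJ : Fin 2 → (F : Type)) (hdJ : ∀ i, IsCMField.complexConj (F : Type) (dJ i) = dJ i) (hdJ0 : ∀ i, dJ i ≠ 0)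
      (hg : formCongr ((IsCMField.complexConj (F : Type) : (F : Type) ≃ₐ[↥(maximalRealSubfield (F : Type))] (F : Type)) :
          (F : Type) →+* (F : Type)) gstar (t • Jstar) = Matrix.diagonal dJ)
      (_hsig : (∃ Tstar : GL (Fin 2) ℂ,
          formCongr (starRingEnd ℂ) Tstar ((Matrix.diagonal dJ).map ι₁) = Matrix.diagonal ![(1 : ℂ), -1]) ∧
        ∀ τ' : (F : Type) →+* ℂ, InfinitePlace.mk τ' ≠ InfinitePlace.mk ι₁ → ((Matrix.diagonal dJ).map τ').PosDef)
      (h4 : 4 ≤ Module.finrank ℚ (F : Type))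
      (r : Rep ↥(maximalRealSubfield (F : Type)) (imagUnitSq F))
      (ε : Eps ↥(maximalRealSubfield (F : Type)) (imagUnitSq F))
      (_hadm : ∃ e : (F : Type), IsAdmissibleElement (F : Type) hμ.cmType.1 e ∧
        epsOf ↥(maximalRealSubfield (F : Type)) (imagUnitSq F) (F : Type) (2 * imagUnit (F : Type))⁻¹ (-e) = ε)
      (χ : Chi ↥(maximalRealSubfield (F : Type)) (F : Type) (IsCMField.complexConj (F : Type)))
      (𝔣 : ConeFrame (F : Type) Jstar (cmPlace (F : Type) ι₁)),
      ((cmPlace (F : Type) ι₁).1.embedding ∈ hμ.cmType.1 →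
        ∀ ψ : Representation.IntertwiningMap
          ((rhoVAtLine ↥(maximalRealSubfield (F : Type)) (F : Type) (IsCMField.complexConj (F : Type)) 2
            (finProdFinEquiv : Fin 2 × Fin 1 ≃ Fin (2 * 1)) (Matrix.diagonal dJ)
            (complexConj_imagUnit F) (imagUnit_ne_zero F) (imagUnit_mul_self F) (realDiagonal_isSymm F dJ hdJ)
            (isUnit_det_realDiagonal F dJ hdJ hdJ0) (realDiagonal_map F dJ hdJ).symm
            (hsChiGS F finProdFinEquiv dJ hdJ hdJ0
              (toHeckeCharacter (F : Type) (galConj (IsCMField.complexConj (F : Type)) μ))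
              (isUnitary_toHeckeCharacter (F : Type) (galConj (IsCMField.complexConj (F : Type)) μ))
              ((isOscillatorChar_toHeckeCharacter_iff (galConj (IsCMField.complexConj (F : Type)) μ)).mpr hμ.galConj))
            (r.toFun ε) χ).comp
            (finAdelicCongr ↥(maximalRealSubfield (F : Type)) (F : Type) (IsCMField.complexConj (F : Type)) gstar ht hg).symm.toMonoidHom)
          (rightRep₂ ↥(maximalRealSubfield (F : Type)) (F : Type) (IsCMField.complexConj (F : Type)) Jstar),
          (∀ w, ψ w ∈ holCotForms₂ ↥(maximalRealSubfield (F : Type)) (F : Type) (IsCMField.complexConj (F : Type)) Jstar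
            (IsCMField.complexConj_ne_one (F : Type)) (UnitaryGroup.complexConj_smul_infinitePlace (F : Type))
            (cmPlace (F : Type) ι₁) 𝔣) → ψ = 0) ∧
      ((cmPlace (F : Type) ι₁).1.embedding ∉ hμ.cmType.1 →
        ∀ ψ : Representation.IntertwiningMap
          ((rhoVAtLine ↥(maximalRealSubfield (F : Type)) (F : Type) (IsCMField.complexConj (F : Type)) 2
            (finProdFinEquiv : Fin 2 × Fin 1 ≃ Fin (2 * 1)) (Matrix.diagonal dJ)
            (complexConj_imagUnit F) (imagUnit_ne_zero F) (imagUnit_mul_self F) (realDiagonal_isSymm F dJ hdJ)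
            (isUnit_det_realDiagonal F dJ hdJ hdJ0) (realDiagonal_map F dJ hdJ).symm
            (hsChiGS F finProdFinEquiv dJ hdJ hdJ0
              (toHeckeCharacter (F : Type) (galConj (IsCMField.complexConj (F : Type)) μ))
              (isUnitary_toHeckeCharacter (F : Type) (galConj (IsCMField.complexConj (F : Type)) μ))
              ((isOscillatorChar_toHeckeCharacter_iff (galConj (IsCMField.complexConj (F : Type)) μ)).mpr hμ.galConj))
            (r.toFun ε) χ).comp
            (finAdelicCongr ↥(maximalRealSubfield (F : Type)) (F : Type) (IsCMField.complexConj (F : Type)) gstar ht hg).symm.toMonoidHom)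
          (rightRep₂ ↥(maximalRealSubfield (F : Type)) (F : Type) (IsCMField.complexConj (F : Type)) Jstar),
          (∀ w, ψ w ∈ (holCotForms₂ ↥(maximalRealSubfield (F : Type)) (F : Type) (IsCMField.complexConj (F : Type)) Jstar
            (IsCMField.complexConj_ne_one (F : Type)) (UnitaryGroup.complexConj_smul_infinitePlace (F : Type))
            (cmPlace (F : Type) ι₁) 𝔣).map (conjFun₂ ↥(maximalRealSubfield (F : Type)) (F : Type) (IsCMField.complexConj (F : Type)) Jstar)) → ψ = 0) := by
  intro F _ ι₁ μ hμ hw Jstar t ht hτt hτt' gstar dJ hdJ hdJ0 hg hsig h4 r ε hadm χ 𝔣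
  -- `J⋆` anisotropic ⇒ an automorphic measure with COMPACT quotient and discretely decomposable `L²`
  obtain ⟨τ, hτ⟩ := UnitaryGroup.exists_infinitePlace_ne (F : Type) h4 ι₁
  have hanis := anisotropic_of_formCongr_posDef (F : Type) Jstar t gstar dJ hg τ (hsig.2 τ hτ)
  obtain ⟨μA, hμA, hdisc⟩ :=
    UnitaryGroup.exists_isAutomorphicMeasure_isDiscretelyDecomposable_adelicGroupData (F : Type) 2 Jstar hanis
  haveI := hμA
  haveI : CompactSpace (adelicGroupData ↥(maximalRealSubfield (F : Type)) (F : Type) (IsCMField.complexConj (F : Type)) 2 Jstar).automorphicQuotient :=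
    UnitaryGroup.compactSpace_cmDatum_automorphicQuotient (F : Type) 2 Jstar hanis
  -- smoothness of `ω⋆_lab` (★)
  have hsmR := isSmoothRep_omegaStarGS F dJ hdJ hdJ0
    (toHeckeCharacter (F : Type) (galConj (IsCMField.complexConj (F : Type)) μ))
    (isUnitary_toHeckeCharacter (F : Type) (galConj (IsCMField.complexConj (F : Type)) μ))
    ((isOscillatorChar_toHeckeCharacter_iff (galConj (IsCMField.complexConj (F : Type)) μ)).mpr hμ.galConj)
    (r.toFun ε) χ ht gstar hg
  have hsm : Representation.IsSmooth ((rhoVAtLine ↥(maximalRealSubfield (F : Type)) (F : Type) (IsCMField.complexConj (F : Type)) 2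
          (finProdFinEquiv : Fin 2 × Fin 1 ≃ Fin (2 * 1)) (Matrix.diagonal dJ)
          (complexConj_imagUnit F) (imagUnit_ne_zero F) (imagUnit_mul_self F) (realDiagonal_isSymm F dJ hdJ)
          (isUnit_det_realDiagonal F dJ hdJ hdJ0) (realDiagonal_map F dJ hdJ).symm
          (hsChiGS F finProdFinEquiv dJ hdJ hdJ0
            (toHeckeCharacter (F : Type) (galConj (IsCMField.complexConj (F : Type)) μ))
            (isUnitary_toHeckeCharacter (F : Type) (galConj (IsCMField.complexConj (F : Type)) μ))
            ((isOscillatorChar_toHeckeCharacter_iff (galConj (IsCMField.complexConj (F : Type)) μ)).mpr hμ.galConj))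
          (r.toFun ε) χ).comp
          (finAdelicCongr ↥(maximalRealSubfield (F : Type)) (F : Type) (IsCMField.complexConj (F : Type)) gstar ht hg).symm.toMonoidHom) :=
    fun v => by
      obtain ⟨S, hS, hfixv⟩ := hsmR v
      exact Representation.isSmoothVector_of_le _ hS fun k hk => hfixv k hk
  -- the 🟧 arithmetic: `Φ_{μᶜ} = Φ̄_μ`, `μᶜ` has weight one, and `ε` IS `μᶜ`-admissible (from `_hadm`, `e ↦ −e`) at the line `r ε`
  have hbar : hμ.galConj.cmType = bar hμ.cmType := hμ.cmType_galConj
  have hwc : HasWeight (F : Type) (galConj (IsCMField.complexConj (F : Type)) μ) 1 := hw.galConj_complexConj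
  have hlocF : locF ↥(maximalRealSubfield (F : Type)) (imagUnitSq F) (r.toFun ε) = ε := by
    obtain ⟨e, -, he⟩ := hadm
    exact r.locF_toFun ε (he ▸ exists_locF_eq_epsOf _ _ _ _ _)
  have hadm' : ∃ e : (F : Type), IsAdmissibleElement (F : Type) hμ.galConj.cmType.1 e ∧
      epsOf ↥(maximalRealSubfield (F : Type)) (imagUnitSq F) (F : Type) (2 * imagUnit (F : Type))⁻¹ e =
        locF ↥(maximalRealSubfield (F : Type)) (imagUnitSq F) (r.toFun ε) := by
    rw [hbar, hlocF]
    exact (exists_isAdmissibleElement_neg_iff_bar hμ.cmType (imagUnitSq F) (2 * imagUnit (F : Type))⁻¹ ε).1 hadm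
  refine ⟨fun hmem ψ hψv => ?_, fun hnmem ψ hψv => ?_⟩
  · -- Branch `e♮ ∈ Φ_μ`: no holomorphic occurrence
    by_contra hψ0
    obtain ⟨w₁, hw₁⟩ : ∃ w, ψ w ≠ 0 := by
      by_contra h
      push Not at h
      exact hψ0 (Representation.IntertwiningMap.ext (LinearMap.ext h))
    haveI hnt : Nontrivial _ := ⟨⟨w₁, 0, fun h => hw₁ (by rw [h, map_zero])⟩⟩
    have hirr := (subsingleton_or_isIrreducible_omegaStarGS F dJ hdJ hdJ0
      (toHeckeCharacter (F : Type) (galConj (IsCMField.complexConj (F : Type)) μ))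
      (isUnitary_toHeckeCharacter (F : Type) (galConj (IsCMField.complexConj (F : Type)) μ))
      ((isOscillatorChar_toHeckeCharacter_iff (galConj (IsCMField.complexConj (F : Type)) μ)).mpr hμ.galConj)
      (r.toFun ε) χ ht gstar hg).resolve_left (not_subsingleton _)
    obtain ⟨P, w, h, hu, hfin⟩ := exists_discreteAutomorphicRep_not_orthogonal_hasFinComponent (μ := μA) hdisc _ hirr ψ.toLinearMap
      (fun g w x => by
        show ψ (_) x = ψ w _
        rw [Representation.IntertwiningMap.isIntertwining]
        rfl)
      (fun w => leftInvariant_of_mem_holCotForms₂ (hψv w))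
      (fun w => continuous_of_mem_holCotForms₂ _ _ _ _ _ _ _ 𝔣 (hψv w))
      (fun h0 => hψ0 (Representation.IntertwiningMap.ext h0))
    -- ed. 2: the letter applied AT HERMITIAN `σ_{w(ι₁)}J⋆` (★ `….apply_herm`), witness from `(ι₁ t).im = 0`
    obtain ⟨f₁, hf₁, hf₁L, heq₁⟩ := hTPhol.apply_herm (F : Type) ι₁ Jstar dJ hdJ hdJ0 t ht gstar hg
      (CurveHodgeTypesDisjoint.isHermitian_map_of_formCongr (F : Type) ι₁ Jstar t ht hτt' gstar dJ hdJ hg _) hsig.1 hsig.2 h4 𝔣 μA P (ψ w) (hψv w) h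
    have hne₁ : MemLp.toLp (toQuotFun _ f₁) hf₁L ≠ 0 := by
      rw [← heq₁, Submodule.starProjection_apply]
      exact Subtype.coe_ne_coe.mpr (orthogonalProjectionOnto_ne_zero P.space hu)
    have hP : P.IsHolCotangentAt₂ (IsCMField.complexConj_ne_one (F : Type)) (UnitaryGroup.complexConj_smul_infinitePlace (F : Type))
        (cmPlace (F : Type) ι₁) 𝔣 := by
      refine ⟨f₁, hf₁, ?_, hf₁L, ?_⟩
      · rintro rfl
        exact hne₁ (MemLp.toLp_zero hf₁L)
      · rw [← heq₁]
        exact Submodule.starProjection_apply_mem _ _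
    have key := hE3hol (F : Type) ι₁ Jstar dJ hdJ hdJ0 t ht gstar hg hsig.1 hsig.2 h4 𝔣 μA finProdFinEquiv
      (galConj (IsCMField.complexConj (F : Type)) μ) hμ.galConj hwc (r.toFun ε) χ _ _ hirr hsm
      ⟨LinearMap.id, fun _ => rfl⟩ (fun _ _ hxy => hxy) P hP hfin
    have hmem' : (cmPlace (F : Type) ι₁).1.embedding ∈ hμ.galConj.cmType.1 := key hadm'
    rw [hbar] at hmem'
    exact (mem_bar_iff hμ.cmType _).1 hmem' hmem
  · -- Branch `e♮ ∉ Φ_μ`: no antiholomorphic occurrence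
    by_contra hψ0
    obtain ⟨w₁, hw₁⟩ : ∃ w, ψ w ≠ 0 := by
      by_contra h
      push Not at h
      exact hψ0 (Representation.IntertwiningMap.ext (LinearMap.ext h))
    haveI hnt : Nontrivial _ := ⟨⟨w₁, 0, fun h => hw₁ (by rw [h, map_zero])⟩⟩
    have hirr := (subsingleton_or_isIrreducible_omegaStarGS F dJ hdJ hdJ0
      (toHeckeCharacter (F : Type) (galConj (IsCMField.complexConj (F : Type)) μ))
      (isUnitary_toHeckeCharacter (F : Type) (galConj (IsCMField.complexConj (F : Type)) μ))
      ((isOscillatorChar_toHeckeCharacter_iff (galConj (IsCMField.complexConj (F : Type)) μ)).mpr hμ.galConj)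
      (r.toFun ε) χ ht gstar hg).resolve_left (not_subsingleton _)
    obtain ⟨P', w', h', hu', hfin'⟩ := exists_discreteAutomorphicRep_not_orthogonal_hasFinComponent (μ := μA) hdisc _ hirr ψ.toLinearMap
      (fun g w x => by
        show ψ (_) x = ψ w _
        rw [Representation.IntertwiningMap.isIntertwining]
        rfl)
      (fun w => leftInvariant_of_mem_map_conjFun₂ (hψv w))
      (fun w => UnitaryCurveForms.continuous_of_mem_map_conjFun₂ _ _ _ _ _ _ _ 𝔣 (hψv w))
      (fun h0 => hψ0 (Representation.IntertwiningMap.ext h0))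
    -- ed. 2: the letter applied AT HERMITIAN `σ_{w(ι₁)}J⋆` (★ `….apply_herm`), witness from `(ι₁ t).im = 0`
    obtain ⟨f₂, hf₂, hf₂L, heq₂⟩ := hTPantihol.apply_herm (F : Type) ι₁ Jstar dJ hdJ hdJ0 t ht gstar hg
      (CurveHodgeTypesDisjoint.isHermitian_map_of_formCongr (F : Type) ι₁ Jstar t ht hτt' gstar dJ hdJ hg _) hsig.1 hsig.2 h4 𝔣 μA P' (ψ w') (hψv w') h'
    have hne₂ : MemLp.toLp (toQuotFun _ f₂) hf₂L ≠ 0 := by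
      rw [← heq₂, Submodule.starProjection_apply]
      exact Subtype.coe_ne_coe.mpr (orthogonalProjectionOnto_ne_zero P'.space hu')
    have hP' : P'.IsAntiholCotangentAt₂ (IsCMField.complexConj_ne_one (F : Type)) (UnitaryGroup.complexConj_smul_infinitePlace (F : Type))
        (cmPlace (F : Type) ι₁) 𝔣 := by
      refine ⟨f₂, hf₂, ?_, hf₂L, ?_⟩
      · rintro rfl
        exact hne₂ (MemLp.toLp_zero hf₂L)
      · rw [← heq₂]
        exact Submodule.starProjection_apply_mem _ _
    have key := hE3antihol (F : Type) ι₁ Jstar dJ hdJ hdJ0 t ht gstar hg hsig.1 hsig.2 h4 𝔣 μA finProdFinEquiv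
      (galConj (IsCMField.complexConj (F : Type)) μ) hμ.galConj hwc (r.toFun ε) χ _ _ hirr hsm
      ⟨LinearMap.id, fun _ => rfl⟩ (fun _ _ hxy => hxy) P' hP' hfin'
    have hnmem' : (cmPlace (F : Type) ι₁).1.embedding ∉ hμ.galConj.cmType.1 := fun hh => key hadm' hh
    rw [hbar] at hnmem'
    exact hnmem' ((mem_bar_iff hμ.cmType _).2 hnmem)

end Summit.HodgeConjecture.HodgeConjecture.Cruxes.HLiu418.F0AlbCmS1bSignedExclusionNec

end
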